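import Mathlib
import Literature.NumberTheory.LFunctions.Zhang2022.SkeletonMeanValue
import Literature.NumberTheory.LFunctions.Zhang2022.SkeletonObjects
import Literature.NumberTheory.LFunctions.Zhang2022.AppendixAKappa2PrimePowers
import Literature.NumberTheory.LFunctions.Zhang2022.AppendixAEulerFactorM2
import Literature.NumberTheory.LFunctions.Zhang2022.AppendixAPrimeProducts

/-!
# Zhang (2022) Appendix A, proof of Lemma 16.1 (iv): Lemma 16.1 in model form — `∏_q F_q(s) = 𝔭 + O(α) + O(D^{−4/5})`

Topic `Literature/NumberTheory/LFunctions/Zhang2022` (Landau–Siegel audit tree; verdict-neutral).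
Y. Zhang, *Discrete mean estimates and the Landau–Siegel zero*, arXiv:2211.02515v1 (2022)
[Zhang2022LandauSiegel] — **an unrefereed manuscript under adjudication**; this file PROVES an
elementary estimate about explicitly defined Euler products and asserts nothing about the manuscript's
theorems. Campaign D-0069, DAG nodes `Z22:Lem16.1.pf` (App. A p. 105, tex L5194–5224) and
`Z22:Lem16.1` / `Z22:§16.u027` [Z22 p. 92, tex L4579–4582] ("Suppose `dl < PT⁻²` and `|s − 1| < 5α`.
Then `𝔪₂*(s) = 𝔭 + O(1/𝓛⁸)`"), feeding `Skeleton.Ded1617`.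

`model_lemma161`: for `D ≥ 2` with `α ≤ 1/50`, `α𝓛 ≤ 1/10` (both hold for `log D ≥ 3`), ANY Dirichlet
character `χ (mod D)` (only `|χ(q)| ≤ 1` is used — Assumption (A) plays no role in Lemma 16.1), any `s`
with `|s − 1| < 5α`, and any set of skipped primes (factor `1`: `∅` when `χ(2) ≠ 1`, `{2}` when
`χ(2) = 1`, matching the two cases of `𝔪₂*` and `𝔭`):
`‖∏'_q F_q(s) − ∏'_q M_q‖ ≤ K · (150(|b₁| + 2|s − 1|) + D^{−4/5})`, `K` absolute — with
`F_q(s) = locF (χ q) (q^{−β₁}) (q^{−s}) q` the closed form of the Euler factor of `𝔪₂(1,1;s)`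
(`AppendixAEulerFactorM2`; = L4-t4's `Typed.Section16A.calM2Factor c′ χ q 1 1 s`, proved in the sequel)
and `M_q = locMain (χ q) q` (= L4-t5's `Typed.Section16B.frakpFactor χ q`). Since `|b₁| ≤ α(1 + 5|c′|α𝓛)`
and `α = π𝓛⁻⁹`, the right side is `O_{c′}(𝓛⁻⁹) + O(D^{−4/5}) ⊂ O(𝓛⁻⁸)`: Lemma 16.1 as printed, one
logarithm to spare. Per-prime inputs: `cpow_neg_beta1_eq_powI`, `norm_cpow_neg_beta1`
(`|q^{−β₁} − 1| ≤ |b₁| log q`), `norm_cpow_neg_le_three_fifths` (`|q^{−s}| = q^{−σ} ≤ 3/5`),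
`norm_one_sub_mul_cpow_neg_le` (`|1 − q^{1−s}| ≤ 2|s−1| log q` for `|s−1| log q ≤ 1/2`).

## References
* Y. Zhang, arXiv:2211.02515v1 (2022), §16 Lemma 16.1 p. 92, Appendix A p. 105.
  [cite: Zhang2022LandauSiegel, §16 Lemma 16.1, App. A]
-/

noncomputable section

open Complex Real Finset Filter Topology

namespace Literature.NumberTheory.LFunctions.Zhang2022.AppendixA

open MeanSquareMajorant

/-! ## §4. The Euler product of `𝔪₂(1,1;s)` against `𝔭`: the model form of Lemma 16.1 -/

section PerPrime

variable (c' : ℝ) {D : ℕ} (χ : DirichletCharacter ℂ D)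

/-- `q^{−β₁} = q^{−ib₁}` is the tree's `powI b₁ q` (`β₁ = ib₁`, (2.13)). [cite: Zhang2022LandauSiegel, §2 (2.13)] -/
theorem cpow_neg_beta1_eq_powI {q : ℕ} (hq : q ≠ 0) :
    (q : ℂ) ^ (-Skeleton.beta1 c' D) = powI (Skeleton.b1 c' D) q := by
  rw [powI_apply_of_ne_zero _ hq]
  congr 1
  simp only [Skeleton.beta1, Skeleton.b1]; push_cast; ring

/-- `‖q^{−β₁}‖ = 1` and `‖q^{−β₁} − 1‖ ≤ |b₁| log q` (App. A p. 105: "`|q^{−β₁} − 1| ≪ α log q`").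
[cite: Zhang2022LandauSiegel, App. A p. 105] -/
theorem norm_cpow_neg_beta1 {q : ℕ} (hq : 0 < q) :
    ‖(q : ℂ) ^ (-Skeleton.beta1 c' D)‖ = 1 ∧
      ‖(q : ℂ) ^ (-Skeleton.beta1 c' D) - 1‖ ≤ |Skeleton.b1 c' D| * Real.log q := by
  rw [cpow_neg_beta1_eq_powI c' hq.ne']
  exact ⟨norm_powI_of_pos _ hq, norm_powI_sub_one_le _ hq⟩

/-- `(3/5)`-bound: for `σ ≥ 9/10` and `q ≥ 2`, `‖q^{−s}‖ = q^{−σ} ≤ 2^{−9/10} ≤ 3/5`.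
[cite: Zhang2022LandauSiegel, §16 p. 91] -/
theorem norm_cpow_neg_le_three_fifths {q : ℕ} (hq : 2 ≤ q) {s : ℂ} (hs : 9 / 10 ≤ s.re) :
    ‖(q : ℂ) ^ (-s)‖ = (q : ℝ) ^ (-s.re) ∧ ‖(q : ℂ) ^ (-s)‖ ≤ 3 / 5 := by
  have hq0 : 0 < q := by omega
  have e : ‖(q : ℂ) ^ (-s)‖ = (q : ℝ) ^ (-s.re) := by
    rw [Complex.norm_natCast_cpow_of_pos hq0, Complex.neg_re]
  refine ⟨e, ?_⟩
  rw [e]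
  have hq2 : (2 : ℝ) ≤ q := by exact_mod_cast hq
  have h1 : (q : ℝ) ^ (-s.re) ≤ (2 : ℝ) ^ (-s.re) :=
    Real.rpow_le_rpow_of_nonpos (by norm_num) hq2 (by linarith)
  have h2 : (2 : ℝ) ^ (-s.re) ≤ (2 : ℝ) ^ (-(9 / 10 : ℝ)) :=
    Real.rpow_le_rpow_of_exponent_le (by norm_num) (by linarith)
  have h3 : (2 : ℝ) ^ (-(9 / 10 : ℝ)) ≤ 3 / 5 := by
    have h10 : ((2 : ℝ) ^ (-(9 / 10 : ℝ))) ^ (10 : ℕ) = 1 / 512 := by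
      rw [← Real.rpow_natCast, ← Real.rpow_mul (by norm_num : (0 : ℝ) ≤ 2),
        show (-(9 / 10 : ℝ)) * ((10 : ℕ) : ℝ) = -((9 : ℕ) : ℝ) by norm_num,
        Real.rpow_neg (by norm_num), Real.rpow_natCast]
      norm_num
    have hpos : (0 : ℝ) ≤ (2 : ℝ) ^ (-(9 / 10 : ℝ)) := by positivity
    exact (pow_le_pow_iff_left₀ hpos (by norm_num) (by norm_num : (10 : ℕ) ≠ 0)).mp
      (by rw [h10]; norm_num)
  linarith

/-- **`q^{1−s} = 1 + O(|s−1| log q)`**: `‖1 − q·q^{−s}‖ ≤ 2‖s − 1‖ log q` whenever `‖s−1‖ log q ≤ 1/2`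
(`q ≥ 1`), and then `‖q·q^{−s}‖ ≤ 2`. [cite: Zhang2022LandauSiegel, App. A p. 105] -/
theorem norm_one_sub_mul_cpow_neg_le {q : ℕ} (hq : 0 < q) {s : ℂ}
    (h : ‖s - 1‖ * Real.log q ≤ 1 / 2) :
    ‖1 - (q : ℂ) * (q : ℂ) ^ (-s)‖ ≤ 2 * ‖s - 1‖ * Real.log q ∧ ‖(q : ℂ) * (q : ℂ) ^ (-s)‖ ≤ 2 := by
  have hq0 : (q : ℂ) ≠ 0 := by exact_mod_cast hq.ne'
  have e1 : (q : ℂ) * (q : ℂ) ^ (-s) = (q : ℂ) ^ (1 - s) := by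
    rw [sub_eq_add_neg, Complex.cpow_add _ _ hq0, Complex.cpow_one]
  have e2 : (q : ℂ) ^ (1 - s) = Complex.exp ((Real.log q : ℂ) * (1 - s)) := by
    rw [Complex.cpow_def_of_ne_zero hq0, ← Complex.natCast_log]
  have hz : ‖(Real.log q : ℂ) * (1 - s)‖ = ‖s - 1‖ * Real.log q := by
    rw [norm_mul, Complex.norm_real, Real.norm_eq_abs, abs_of_nonneg (Real.log_natCast_nonneg q),
      ← norm_neg (1 - s), neg_sub, mul_comm]
  have key : ‖1 - (q : ℂ) * (q : ℂ) ^ (-s)‖ ≤ 2 * ‖s - 1‖ * Real.log q := by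
    rw [e1, e2, ← norm_neg, neg_sub]
    calc ‖Complex.exp ((Real.log q : ℂ) * (1 - s)) - 1‖ ≤ 2 * ‖(Real.log q : ℂ) * (1 - s)‖ :=
          Complex.norm_exp_sub_one_le (by rw [hz]; linarith)
      _ = 2 * ‖s - 1‖ * Real.log q := by rw [hz]; ring
  refine ⟨key, ?_⟩
  calc ‖(q : ℂ) * (q : ℂ) ^ (-s)‖ = ‖1 - (1 - (q : ℂ) * (q : ℂ) ^ (-s))‖ := by ring_nf
    _ ≤ ‖(1 : ℂ)‖ + ‖1 - (q : ℂ) * (q : ℂ) ^ (-s)‖ := norm_sub_le _ _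
    _ ≤ 1 + 1 := by
        rw [norm_one]; gcongr
        calc ‖1 - (q : ℂ) * (q : ℂ) ^ (-s)‖ ≤ 2 * ‖s - 1‖ * Real.log q := key
          _ = 2 * (‖s - 1‖ * Real.log q) := by ring
          _ ≤ 2 * (1 / 2) := by gcongr
          _ = 1 := by norm_num
    _ = 2 := by norm_num

end PerPrime

section Model

variable (c' : ℝ) {D : ℕ} (χ : DirichletCharacter ℂ D)

/-- **Lemma 16.1, model form** (App. A p. 105 ⇒ §16 p. 92): for `D ≥ 2` with `α ≤ 1/50`,
`α𝓛 ≤ 1/10`, any Dirichlet character `χ (mod D)`, `|s − 1| < 5α`, and any set of "skipped" primes (factor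
`1`; `∅` for the case `χ(2) ≠ 1`, `{2}` for `χ(2) = 1`), the Euler product of the closed-form factors
`F_q(s)` is within `K(150(|b₁| + 2|s−1|) + D^{−4/5})` of the product of the main factors `M_q`, with the
absolute constant `K` of `exists_assembly_const` — i.e. `O(α) + O(D^{−4/5}) = O(𝓛⁻⁸)`.
[cite: Zhang2022LandauSiegel, §16 Lemma 16.1, App. A p. 105] -/
theorem model_lemma161 : ∃ K : ℝ, 0 < K ∧
    ∀ (c' : ℝ) (D : ℕ) (χ : DirichletCharacter ℂ D) (skip : ℕ → Prop) [DecidablePred skip],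
      2 ≤ D → Skeleton.alpha D ≤ 1 / 50 → Skeleton.alpha D * Skeleton.ell D ≤ 1 / 10 →
      ∀ s : ℂ, ‖s - 1‖ < 5 * Skeleton.alpha D →
        ‖(∏' q : Nat.Primes, if skip q then (1 : ℂ) else
            locF (χ ((q : ℕ) : ZMod D)) (((q : ℕ) : ℂ) ^ (-Skeleton.beta1 c' D))
              (((q : ℕ) : ℂ) ^ (-s)) q) -
          ∏' q : Nat.Primes, if skip q then (1 : ℂ) else locMain (χ ((q : ℕ) : ZMod D)) q‖ ≤
        K * (150 * (|Skeleton.b1 c' D| + 2 * ‖s - 1‖) + (D : ℝ) ^ (-(4 / 5 : ℝ))) := by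
  obtain ⟨K, hK, hA⟩ := exists_assembly_const
  refine ⟨K, hK, fun c' D χ skip _ hD hα hαℓ s hs => ?_⟩
  have hα0 : 0 ≤ Skeleton.alpha D := by
    unfold Skeleton.alpha Skeleton.bigP
    rw [Real.log_exp]
    exact div_nonneg Real.pi_pos.le (pow_nonneg (Real.log_natCast_nonneg D) 9)
  have hs1 : ‖s - 1‖ ≤ 1 / 10 := by linarith
  have hσ : 9 / 10 ≤ s.re := by
    have h := Complex.abs_re_le_norm (s - 1)
    rw [Complex.sub_re, Complex.one_re] at h
    have := (abs_le.mp (h.trans hs1)).1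
    linarith
  have hℓ : Skeleton.ell D = Real.log D := rfl
  -- per-prime hypotheses
  refine hA s.re hσ D (by omega) (150 * (|Skeleton.b1 c' D| + 2 * ‖s - 1‖)) (by positivity) _ _
    (fun q => ?_) (fun q => ?_) (fun q hqD => ?_)
  · -- tail estimate
    by_cases hq : skip q
    · simp only [hq, if_true, sub_self, norm_zero]; positivity
    · simp only [hq, if_false]
      have hv := DirichletCharacter.norm_le_one χ ((q : ℕ) : ZMod D)
      obtain ⟨hw, -⟩ := norm_cpow_neg_beta1 c' (D := D) q.prop.pos
      obtain ⟨ex, hx⟩ := norm_cpow_neg_le_three_fifths q.prop.two_le hσ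
      calc _ ≤ 225 * ‖((q : ℕ) : ℂ) ^ (-s)‖ / (q : ℕ) :=
            norm_locF_sub_one_le hv hw.le hx q.prop.two_le
        _ = 225 * ((q : ℕ) : ℝ) ^ (-s.re) / (q : ℕ) := by rw [ex]
  · -- main factors are `1 + O(q⁻²)`
    by_cases hq : skip q
    · simp only [hq, if_true, sub_self, norm_zero]; positivity
    · simp only [hq, if_false]
      exact norm_locMain_sub_one_le (DirichletCharacter.norm_le_one χ _) q.prop.two_le
  · -- the primes `q ≤ D`: `F_q − M_q = O((|b₁| + |s−1|) log q / q²)`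
    by_cases hq : skip q
    · simp only [hq, if_true, sub_self, norm_zero]
      exact div_nonneg (mul_nonneg (by positivity) (Real.log_natCast_nonneg _)) (by positivity)
    · simp only [hq, if_false]
      have hv := DirichletCharacter.norm_le_one χ ((q : ℕ) : ZMod D)
      obtain ⟨hw, hw1⟩ := norm_cpow_neg_beta1 c' (D := D) q.prop.pos
      obtain ⟨-, hx⟩ := norm_cpow_neg_le_three_fifths q.prop.two_le hσ
      have hlogq : Real.log (q : ℕ) ≤ Skeleton.ell D := by
        rw [hℓ]; exact Real.log_le_log (by exact_mod_cast q.prop.pos) (by exact_mod_cast hqD)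
      have hlog0 : 0 ≤ Real.log (q : ℕ) := Real.log_natCast_nonneg _
      have hsl : ‖s - 1‖ * Real.log (q : ℕ) ≤ 1 / 2 := by
        calc ‖s - 1‖ * Real.log (q : ℕ) ≤ (5 * Skeleton.alpha D) * Skeleton.ell D :=
              mul_le_mul hs.le hlogq hlog0 (by positivity)
          _ = 5 * (Skeleton.alpha D * Skeleton.ell D) := by ring
          _ ≤ 1 / 2 := by linarith
      obtain ⟨h1x, hqx⟩ := norm_one_sub_mul_cpow_neg_le q.prop.pos hsl
      calc _ ≤ 150 * (‖((q : ℕ) : ℂ) ^ (-Skeleton.beta1 c' D) - 1‖ +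
              ‖1 - ((q : ℕ) : ℂ) * ((q : ℕ) : ℂ) ^ (-s)‖) / ((q : ℕ) : ℝ) ^ 2 :=
            norm_locF_sub_locMain_le hv hw.le hx hqx q.prop.two_le
        _ ≤ 150 * (|Skeleton.b1 c' D| * Real.log (q : ℕ) + 2 * ‖s - 1‖ * Real.log (q : ℕ)) /
              ((q : ℕ) : ℝ) ^ 2 := by gcongr
        _ = 150 * (|Skeleton.b1 c' D| + 2 * ‖s - 1‖) * Real.log (q : ℕ) / ((q : ℕ) : ℝ) ^ 2 := by
            ring

end Model

end Literature.NumberTheory.LFunctions.Zhang2022.AppendixA
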